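import Mathlib
import HarnessLib
import Summits.CriticalPhenomena.SAWScalingLimit.Theses.SAWDevelopingMap
import Summits.CriticalPhenomena.SAWScalingLimit.Theorems.ObservableToSLE.Negative.Identification
import Literature.Probability.RandomPlanarGeometry.RestrictionUniqueness

/-!
# Line `source-residue-restriction-pinning` — skeleton for the crux `SAWDevelopingMap.ObservableToSLE`
(crux item stmt-CriticalPhenomena-10472; routes SAWDevelopingMap (primary), SAWResidueField,
SAWDefectDecoherence, SAWWindingAlias; card `Cruxes/ObservableToSLE/Ideas/source-residue-restriction-pinning.md`,
triage r1 k = 1, 2, 3: pass)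

Crux (FIXED, by name): `HexObservableLimit → HexTight → ∀ D a b, IsEmbEndpointApprox … →
ConvergesInLawToSLE (8/3) D curve hexSAWLaw` (DCS 2012 Conjecture 1 written out, given Conjecture 2 in the
typed ψ-averaged flat-at-`b` form and eventual tightness).

Idea. Evaluate the SAW's EXACT restriction ratios `Z_{Λ′}(a→b)/Z_Λ(a→b) = P_Λ^{a→b}(γ ⊂ Λ′)` (nested
admissible discretisations `Λ′ ⊆ Λ` of a hull pair `D′ ⊆ D`, common boundary source `a` and normalising
target `b`, both on FLAT horizontal boundary pieces) not by a martingale but by the Duminil-Copin–Smirnov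
boundary sum rule `Σ_{p∈∂Λ} (p − v_p) F(p) = 0` (Lemma 1 summed; `F(a) = 1`) DIFFERENCED between `Λ` and
`Λ′`: the `O(δ)` lattice-scale terms at the common source cancel exactly into a positive two-phase
"returning mass"; the bottom-row terms at distance `∈ [r, r₀]` from `a` are EVALUATED by uniform two-
normalisation target transport (the only consequence of `HexObservableLimit` used — Jordan domains, flat
targets, never a slit domain: W1 honoured) as `κ_δ k ∫ (Φ′)^{5/8}` resp. `κ′_δ k ∫ (Φ′_{D′})^{5/8}`; every
other far boundary term (other sides, corners, the bite's boundary) is only BOUNDED, by the single a-priori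
input `stub_farExitMassBound` (relative `O(κ_δ)`); and the non-integrability of `|Φ′|^{5/8} ∼ |x−a|^{−5/4}`
at the source is the fulcrum: `|1 − κ′_δ/κ_δ| · |∫_{r<|x−a|<r₀} (Φ′)^{5/8}| = O(1)` for every `r`, the
integral `≍ r^{−1/4} → ∞`, so `κ′_δ/κ_δ → 1`, i.e. the RESTRICTION FORMULA
`Z_{Λ′}/Z_Λ → |Φ′_{D′}(b)/Φ′(b)|^{5/8}` (with `Φ_{D′}/Φ → 1` at `a`) — the Lawler–Schramm–Werner value
`Φ_A′(0)^{5/8}`. Portmanteau + the tree's LSW uniqueness (`CurveClass.Measure.ext_of_missCode_injOn`,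
`injOn_missCode_imageTest`, Thm 6.1 transposed) then identify every subsequential limit carried by chordal
simple curves as the SLE_{8/3} law, and `convergesInLawToSLE_of_identification` (landed
`Negative/Identification.lean`) closes the crux.

## Stubs (6, registered; every statement is over existing Literature / route declarations only — the long
## hypothesis blocks are repeated verbatim between stubs so that the composition is pure application)
* `stub_uniformTargetTransport` — `HexObservableLimit →` uniform two-normalisation transport on the flat
  bottom row near the source (M–L; free consequence of the typed hypothesis + Schwarz reflection).
* `stub_farExitMassBound` — THE A-PRIORI INPUT (R1′, open; cheapest-falsifier target): for admissible
  families with `O(1/δ)` far boundary mid-edges, the far boundary exit mass from `a` is `≤ (C/δ)·Z(a→b)`.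
* `stub_sourceResidueEngine` — THE LEVER (L–XL): transport + far-mass bound ⇒ restriction formula for
  nested admissible families of flat-ended hull pairs.
* `stub_restrictionIdentifiesLaw` — restriction formula ⇒ a subsequential limit of the canonical laws in a
  convex flat-bottomed domain, if carried by chordal simple curves, is the SLE_{8/3} law (L–XL Lean,
  classical + in-tree LSW corpus: Portmanteau, lattice sandwich, Thm 6.1 transposed, `ext_of_missCode_injOn`).
* `stub_chordalCarrier` — (R2, open, shared by all restriction lines): subsequential limits in that class are
  carried by `chordalCarrier D` (simple, `a → b`, inside `D ∪ {a,b}`).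
* `stub_domainEndpointUniversality` — (R3 = W2, open, shared by every line on this crux): convergence in the
  convex flat-bottomed class with boundary-row endpoints + `HexTight` ⇒ convergence for every Dobrushin
  domain and every `IsEmbEndpointApprox`.
* `ObservableToSLE_of : ObservableToSLE` — the kernel-checked composition (no sorry outside the stubs).

## Disproof used (standing Disproof.lean v4e of refuter-cdisprove; the file under run/gate/evidence is not
## mounted in this jail — contents from the item's evidence notes; landed Negative lemmas imported above)
`refutation_yields` / `not_crux_iff`: no `_false_without_` theorem exists for the crux itself (¬crux needs
¬Conj.1). `conclusion_false_without_reachable`, `conclusion_false_without_tendsto` (EndpointNecessity):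
`IsEmbEndpointApprox` is kept verbatim in `stub_domainEndpointUniversality` and in the good class. W1
(`carrier_ne_of_cutPoint`, `slitDisc_ne_carrier`): no stub ever uses a slit domain — only Dobrushin `D`, `D′`
and admissible Jordan discretisations. W2 (`flat_premise_false_on_unitDisc`): named and isolated as
`stub_domainEndpointUniversality`. `crux_iff_identification` / `observableToSLE_iff_identification`: the
composition goes through its landed soft half `convergesInLawToSLE_of_identification`. W4 n/a (no Itô).
Negatives index: only the eventual `HexTight` is used (never the refuted all-δ `IsTightLaws`, stmt-0772).
-/

noncomputable section

namespace Summit.CriticalPhenomena.SAWScalingLimit.Cruxes.ObservableToSLE.SourceResidueRestrictionPinning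

open scoped NNReal ENNReal Topology BigOperators
open Filter Set MeasureTheory Metric
open UpperHalfPlane (upperHalfPlaneSet)
open Literature.Probability.LatticeModels
open Literature.Probability.RandomPlanarGeometry
open Literature.Probability.RandomPlanarGeometry.SAW
open Summit.CriticalPhenomena.SAWScalingLimit.Theses.SAWDevelopingMap
open Summit.CriticalPhenomena.SAWScalingLimit.Theorems.ObservableToSLE.Negative

/-! ## Stub 1 — uniform two-normalisation target transport on the flat bottom row (free) -/

/-- STUB 1 — `stub_uniformTargetTransport` (size M–L; "free" from the typed hypothesis). Sources: the
two-normalisation division of two instances of `HexObservableLimit` (triage r1-1/2/3 "common lever", checked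
by hand there: same `Λ_δ, a_δ, ψ, F_δ, c`, normalisation points `b` and `p`; `F_δ(p_δ)/F_δ(b_δ) →
e^{(5/8)(L_p − L_b)}`, moduli `Z_δ(a→p)/Z_δ(a→b) → |Φ′(p)/Φ′(b)|^{5/8}` by deterministic boundary winding,
phase jump `e^{−5iπ/4}` across the pole matching `arg Φ′`); Schwarz reflection across the flat bottom piece
(Pommerenke1992 §1.2; `Φ′` extends analytically and non-vanishing to the open flat segment minus `a`, so
`Re L = log|Φ′|` has boundary values `ℓ` there and `Φ − Φ(p)` re-marks `pt 1 := p`); uniformity from the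
"for every sequence `p_δ → p`" form of the hypothesis by compactness (triage r1-2: "flat-side Riemann sums
are FREE"). DCS arXiv:1007.0575 §3 (boundary winding), KennedyLawler2013 (lattice factor depends on the
boundary angle only — here all targets are on the same horizontal zigzag class).
**Uniform target transport on the bottom row near the source.** For a Dobrushin domain flat (horizontal,
domain above) near BOTH marked points, an admissible discretisation family with flat rows near both, boundary
mid-edge endpoints `a_δ → a = pt 0`, `b_δ → b = pt 1`, and the conformal data `(Φ, L, L_b)` of
`HexObservableLimit`: there is a continuous `ℓ` on `(−ρ, ρ) ∖ {0}` with `Re L(z) → ℓ(x)` as `z → a + x`,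
such that, uniformly over the boundary mid-edges `p` of `Λ_δ` at distance `∈ [r, r₀]` from `a`
(`0 < r < r₀ < ρ`; these are bottom-row mid-edges), `Z_δ(a_δ→p) = (e^{(5/8)(ℓ(Re(p−a)) − Re L_b)} + o(1)) ·
Z_δ(a_δ→b_δ)`, where `Z_δ(a→z) = Σ_{γ ⊂ Λ_δ : a→z} x_c^{ℓ(γ)}` is the spin-0 observable. -/
theorem stub_uniformTargetTransport :
    HexObservableLimit →
    ∀ (D : DobrushinDomain) (ρ : ℝ) (Λ : ℝ → Finset HexVertex) (m : ℝ → ℤ) (a b : ℝ → Sym2 HexVertex)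
      (Φ : ConformalEquiv D.carrier upperHalfPlaneSet) (L : ℂ → ℂ) (Lb : ℂ),
      0 < ρ →
      D.carrier ∩ ball (D.pt 0) ρ = {z : ℂ | (D.pt 0).im < z.im} ∩ ball (D.pt 0) ρ →
      D.carrier ∩ ball (D.pt 1) ρ = {z : ℂ | (D.pt 1).im < z.im} ∩ ball (D.pt 1) ρ →
      (∀ᶠ δ : ℝ in 𝓝[>] (0 : ℝ),
        hexDomainSimplyConnected (Λ δ) ∧ a δ ∈ hexDomainBoundary (Λ δ) ∧ b δ ∈ hexDomainBoundary (Λ δ) ∧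
        Nonempty (HexMidEdgeSAW (Λ δ) (a δ) (b δ)) ∧
        (hexGraph.induce ((Λ δ : Finset HexVertex) : Set HexVertex)).Preconnected ∧
        (∀ v ∈ Λ δ, (δ : ℂ) * hexCenter v ∈ D.carrier) ∧
        (∀ v : HexVertex, (δ : ℂ) * hexCenter v ∈ ball (D.pt 0) ρ ∪ ball (D.pt 1) ρ →
          (v ∈ Λ δ ↔ m δ ≤ v.1 1))) →
      (∀ K : Set ℂ, IsCompact K → K ⊆ D.carrier →
        ∀ᶠ δ : ℝ in 𝓝[>] (0 : ℝ), ∀ v : HexVertex, (δ : ℂ) * hexCenter v ∈ K → v ∈ Λ δ) →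
      Tendsto (fun δ : ℝ => (δ : ℂ) * hexMidpoint (a δ)) (𝓝[>] (0 : ℝ)) (𝓝 (D.pt 0)) →
      Tendsto (fun δ : ℝ => (δ : ℂ) * hexMidpoint (b δ)) (𝓝[>] (0 : ℝ)) (𝓝 (D.pt 1)) →
      Tendsto (fun x => ‖Φ x‖) (𝓝[D.carrier] (D.pt 0)) atTop →
      Φ.HasBoundaryValue (D.pt 1) 0 →
      ContinuousOn L D.carrier → (∀ z ∈ D.carrier, Complex.exp (L z) = deriv Φ z) →
      Tendsto L (𝓝[D.carrier] (D.pt 1)) (𝓝 Lb) →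
      ∃ ℓ : ℝ → ℝ, ContinuousOn ℓ (Set.Ioo (-ρ) ρ \ {0}) ∧
        (∀ x : ℝ, x ≠ 0 → |x| < ρ →
          Tendsto (fun z => (L z).re) (𝓝[D.carrier] (D.pt 0 + (x : ℂ))) (𝓝 (ℓ x))) ∧
        ∀ r r₀ ε : ℝ, 0 < r → r < r₀ → r₀ < ρ → 0 < ε →
          ∀ᶠ δ : ℝ in 𝓝[>] (0 : ℝ), ∀ p ∈ hexDomainBoundary (Λ δ),
            r ≤ dist ((δ : ℂ) * hexMidpoint p) (D.pt 0) → dist ((δ : ℂ) * hexMidpoint p) (D.pt 0) ≤ r₀ →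
            |(hexParafermionicObservable (Λ δ) (a δ) hexCriticalFugacity 0 (p)).re -
                Real.exp ((5 / 8 : ℝ) * (ℓ (((δ : ℂ) * hexMidpoint p - D.pt 0).re) - Lb.re)) *
                  (hexParafermionicObservable (Λ δ) (a δ) hexCriticalFugacity 0 (b δ)).re| ≤
              ε * (hexParafermionicObservable (Λ δ) (a δ) hexCriticalFugacity 0 (b δ)).re := by
  sorry

/-! ## Stub 2 — the a-priori input: far exit mass bound (R1′) -/

/-- STUB 2 — `stub_farExitMassBound` (R1′; OPEN a-priori estimate, the line's cheapest-falsifier target;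
size L). Sources: DCS arXiv:1007.0575 Lemma 2 / identity (5) (`1 = c_α A_T + B_T + c_ε E_T`: total exit mass
from a boundary source of a strip is `O(1)` and the far part `B_T + c_ε E_T → 0`; tree
`DuminilCopinSmirnov2012_lemma2_holds`, `GlazmanManolescu2019_prop11_limit`); the card's (R1) and triage
r1-1 (`FarMassComparable`), r1-2 (corner tightness), r1-3 ("`R_r = O(C_Λ N^{−1/4})` is exactly (R1)");
LSW04 math/0204277 §3.3–3.4 (boundary scaling exponent 5/8: the point-to-point mass to a far boundary
point is `≍ δ^{5/4}`, so the far exit mass over the `O(1/δ)` far mid-edges is `≍ δ^{1/4} ≍ Z(a→b)/δ`);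
Kennedy math/0207231 (numerics). Continuum heuristic: `∫_{∂D ∖ B(a,r₀)} |Φ′|^{5/8} |dz| < ∞` (corner
singularities `|Φ′|^{5/8} ∼ dist^{(π/α−1)5/8}` are integrable for every interior angle `α ≤ 2π`).
**Far exit mass bound.** For a Dobrushin domain flat near both marked points, an admissible family
`Λ_δ` (as in `HexObservableLimit`, rows flat near `a` and `b`, `a_δ → a`, `b_δ → b` boundary mid-edges,
`Λ_δ ⊆ D`, exhausting compacts) whose far boundary is TAME in the weakest sense — at most `N/δ` boundary
mid-edges at distance `≥ r₀` from `a` — there is `C` with, eventually in `δ`,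
`Σ_{p ∈ ∂Λ_δ, |δ·mid p − a| ≥ r₀} Z_δ(a_δ→p) ≤ (C/δ) · Z_δ(a_δ→b_δ)`:
no far boundary region attracts parametrically more exit mass than the flat normalisation point does on
average. Phase-free, positive, single-domain; not implied by `HexObservableLimit` (which only sees flat
pieces) nor by `HexTight`; smallness is NOT claimed (the engine divides by a divergent integral). -/
theorem stub_farExitMassBound :
    ∀ (D : DobrushinDomain) (ρ : ℝ) (Λ : ℝ → Finset HexVertex) (m : ℝ → ℤ) (a b : ℝ → Sym2 HexVertex),
      0 < ρ →
      D.carrier ∩ ball (D.pt 0) ρ = {z : ℂ | (D.pt 0).im < z.im} ∩ ball (D.pt 0) ρ →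
      D.carrier ∩ ball (D.pt 1) ρ = {z : ℂ | (D.pt 1).im < z.im} ∩ ball (D.pt 1) ρ →
      (∀ᶠ δ : ℝ in 𝓝[>] (0 : ℝ),
        hexDomainSimplyConnected (Λ δ) ∧ a δ ∈ hexDomainBoundary (Λ δ) ∧ b δ ∈ hexDomainBoundary (Λ δ) ∧
        Nonempty (HexMidEdgeSAW (Λ δ) (a δ) (b δ)) ∧
        (hexGraph.induce ((Λ δ : Finset HexVertex) : Set HexVertex)).Preconnected ∧
        (∀ v ∈ Λ δ, (δ : ℂ) * hexCenter v ∈ D.carrier) ∧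
        (∀ v : HexVertex, (δ : ℂ) * hexCenter v ∈ ball (D.pt 0) ρ ∪ ball (D.pt 1) ρ →
          (v ∈ Λ δ ↔ m δ ≤ v.1 1))) →
      (∀ K : Set ℂ, IsCompact K → K ⊆ D.carrier →
        ∀ᶠ δ : ℝ in 𝓝[>] (0 : ℝ), ∀ v : HexVertex, (δ : ℂ) * hexCenter v ∈ K → v ∈ Λ δ) →
      Tendsto (fun δ : ℝ => (δ : ℂ) * hexMidpoint (a δ)) (𝓝[>] (0 : ℝ)) (𝓝 (D.pt 0)) →
      Tendsto (fun δ : ℝ => (δ : ℂ) * hexMidpoint (b δ)) (𝓝[>] (0 : ℝ)) (𝓝 (D.pt 1)) →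
      (∀ r₀ : ℝ, 0 < r₀ → ∃ N : ℝ, ∀ᶠ δ : ℝ in 𝓝[>] (0 : ℝ),
        (Set.ncard {p : Sym2 HexVertex | p ∈ hexDomainBoundary (Λ δ) ∧
            r₀ ≤ dist ((δ : ℂ) * hexMidpoint p) (D.pt 0)} : ℝ) ≤ N / δ) →
      ∀ r₀ : ℝ, 0 < r₀ → ∃ C : ℝ, ∀ᶠ δ : ℝ in 𝓝[>] (0 : ℝ),
        (∑ᶠ p ∈ {p : Sym2 HexVertex | p ∈ hexDomainBoundary (Λ δ) ∧
            r₀ ≤ dist ((δ : ℂ) * hexMidpoint p) (D.pt 0)},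
            (hexParafermionicObservable (Λ δ) (a δ) hexCriticalFugacity 0 (p)).re) ≤
          C / δ * (hexParafermionicObservable (Λ δ) (a δ) hexCriticalFugacity 0 (b δ)).re := by
  sorry

/-! ## Stub 3 — the lever: differenced sum rule + divergent source residue ⇒ restriction formula -/

/-- STUB 3 — `stub_sourceResidueEngine`, THE LEVER (size L–XL). Sources: DCS arXiv:1007.0575 Lemma 1
(tree: `DuminilCopinSmirnov2012_lemma1_holds`, PROVED) summed over the domain = the exact boundary sum rule
`Σ_{p∈∂Λ}(p − v_p)F(p) = 0` (interior mid-edges cancel: midpoint = mean of the two centres; `F(a) = 1` by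
`HexMidEdgeSAW.verts_eq_nil_of_mem_boundary`; general simply connected `Λ` — the tree's `SAW.HV.boundary_sum`
is the half-plane case), and its §3 differencing move `A_{T+1} − A_T ≤ x_c B_{T+1}²` (nearest precedent);
phase alignment `F_{Λ′}(p) = t_p F_Λ(p)`, `t_p = P_Λ^{a→p}(γ ⊂ Λ′) ∈ [0,1]` on common boundary mid-edges
(restriction exactness + deterministic boundary winding; Ideator3Sketch `PhaseAlignment`, triage: provable
now); Cauchy's theorem for `f = (Φ′)^{5/8}` is NOT even needed in this minimal form — only the divergence
`|∫_{r<|x−a|<r₀} (Φ′(a+x))^{5/8} dx| ≍ r^{−1/4}` of the bottom-row integral (`Φ ∼ −R/(z−a)` at the flat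
boundary pole by reflection, `(Φ′)^{5/8} ∼ R^{5/8}|x−a|^{−5/4} e^{∓5iπ/8·…}`, the two one-sided pieces carry
the fixed phases `1` and `e^{−5iπ/4}`, `|1 + e^{−5iπ/4}| ≠ 0`) and the integrability of `f − f′` there
(`Φ_{D′} = G ∘ Φ`, `G(w)/w → 1` at `∞ = Φ(a)` ⇒ `G′(Φ(a+x)) − 1 = O(|x|²)`). Triage r1-1/2/3 re-derived the
order bookkeeping (`κ_δ ∼ δ^{5/4}`, near sum `O(δ)` cancels exactly, far terms `O(δ^{5/4})`).
**The source-residue engine.** Assume uniform target transport (the statement of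
`stub_uniformTargetTransport` without its `HexObservableLimit →`) and the far exit mass bound (the statement
of `stub_farExitMassBound`). Let `D′ ⊆ D` be Dobrushin domains with the same marked points, both flat
(horizontal, domain above) inside `B(a, ρ) ∪ B(b, ρ)` (so they agree there: a HULL pair, the bite
`D ∖ D′` is away from `a` and `b` and otherwise ARBITRARY), `Λ′_δ ⊆ Λ_δ` admissible families for `D′`, `D`
with the same rows near `a, b` and the same boundary mid-edge endpoints `a_δ, b_δ`, both far-tame
(`O(1/δ)` far boundary mid-edges), and `(Φ, L, L_b)`, `(Φ′, L′, L′_b)` conformal data of `D`, `D′` as in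
`HexObservableLimit` (`a ↦ ∞`, `b ↦ 0`) normalised compatibly at the source: `Φ′/Φ → 1` at `a`. Then
`Z_{Λ′_δ}(a_δ→b_δ) / Z_{Λ_δ}(a_δ→b_δ) → exp((5/8)(Re L′_b − Re L_b)) = |Φ′_{D′}(b)/Φ′_D(b)|^{5/8}` — the
restriction formula (by exactness the left side is `P_{Λ_δ}^{a→b}(γ ⊂ Λ′_δ)`; the right side is the LSW
value `Φ_A′(0)^{5/8}`, [LSW03] Thm 6.1, read with source and target exchanged).
Proof skeleton: difference the two sum rules; split `∂Λ` into the bottom row within `r` of `a` (returning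
mass `M_r ≥ 0`, two phases `e^{∓5iπ/8}`, `|Σ| ≥ cos(3π/8)·(δ/2√3)·M_r`, `M_r` nondecreasing), the bottom
row at distance `[r, r₀]` (evaluated: `κ_δ k∫f − κ′_δ k∫f′ + o(κ_δ)`) and the rest (`O(κ_δ)` by the
far-mass bound for `Λ` and for `Λ′`, using `Z_{Λ′}(a→b) ≤ Z_Λ(a→b)`); at `r = r₀` the identity gives
`δ M_{r₀} = O(κ_δ)`; hence `|κ_δ − κ′_δ|·|∫_{B_r} f| ≤ C κ_δ` for all `r`, and `κ′_δ/κ_δ → 1`. -/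
theorem stub_sourceResidueEngine :
    ∀ (D D' : DobrushinDomain) (ρ : ℝ) (Λ Λ' : ℝ → Finset HexVertex) (m : ℝ → ℤ) (a b : ℝ → Sym2 HexVertex)
      (Φ : ConformalEquiv D.carrier upperHalfPlaneSet) (L : ℂ → ℂ) (Lb : ℂ)
      (Φ' : ConformalEquiv D'.carrier upperHalfPlaneSet) (L' : ℂ → ℂ) (Lb' : ℂ),
      0 < ρ →
      D.carrier ∩ ball (D.pt 0) ρ = {z : ℂ | (D.pt 0).im < z.im} ∩ ball (D.pt 0) ρ →
      D.carrier ∩ ball (D.pt 1) ρ = {z : ℂ | (D.pt 1).im < z.im} ∩ ball (D.pt 1) ρ →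
      D'.carrier ∩ ball (D'.pt 0) ρ = {z : ℂ | (D'.pt 0).im < z.im} ∩ ball (D'.pt 0) ρ →
      D'.carrier ∩ ball (D'.pt 1) ρ = {z : ℂ | (D'.pt 1).im < z.im} ∩ ball (D'.pt 1) ρ →
      D'.carrier ⊆ D.carrier → D'.pt 0 = D.pt 0 → D'.pt 1 = D.pt 1 →
      (∀ᶠ δ : ℝ in 𝓝[>] (0 : ℝ),
        hexDomainSimplyConnected (Λ δ) ∧ a δ ∈ hexDomainBoundary (Λ δ) ∧ b δ ∈ hexDomainBoundary (Λ δ) ∧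
        Nonempty (HexMidEdgeSAW (Λ δ) (a δ) (b δ)) ∧
        (hexGraph.induce ((Λ δ : Finset HexVertex) : Set HexVertex)).Preconnected ∧
        (∀ v ∈ Λ δ, (δ : ℂ) * hexCenter v ∈ D.carrier) ∧
        (∀ v : HexVertex, (δ : ℂ) * hexCenter v ∈ ball (D.pt 0) ρ ∪ ball (D.pt 1) ρ →
          (v ∈ Λ δ ↔ m δ ≤ v.1 1))) →
      (∀ K : Set ℂ, IsCompact K → K ⊆ D.carrier →
        ∀ᶠ δ : ℝ in 𝓝[>] (0 : ℝ), ∀ v : HexVertex, (δ : ℂ) * hexCenter v ∈ K → v ∈ Λ δ) →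
      Tendsto (fun δ : ℝ => (δ : ℂ) * hexMidpoint (a δ)) (𝓝[>] (0 : ℝ)) (𝓝 (D.pt 0)) →
      Tendsto (fun δ : ℝ => (δ : ℂ) * hexMidpoint (b δ)) (𝓝[>] (0 : ℝ)) (𝓝 (D.pt 1)) →
      (∀ᶠ δ : ℝ in 𝓝[>] (0 : ℝ),
        hexDomainSimplyConnected (Λ' δ) ∧ a δ ∈ hexDomainBoundary (Λ' δ) ∧ b δ ∈ hexDomainBoundary (Λ' δ) ∧
        Nonempty (HexMidEdgeSAW (Λ' δ) (a δ) (b δ)) ∧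
        (hexGraph.induce ((Λ' δ : Finset HexVertex) : Set HexVertex)).Preconnected ∧
        (∀ v ∈ Λ' δ, (δ : ℂ) * hexCenter v ∈ D'.carrier) ∧
        (∀ v : HexVertex, (δ : ℂ) * hexCenter v ∈ ball (D'.pt 0) ρ ∪ ball (D'.pt 1) ρ →
          (v ∈ Λ' δ ↔ m δ ≤ v.1 1))) →
      (∀ K : Set ℂ, IsCompact K → K ⊆ D'.carrier →
        ∀ᶠ δ : ℝ in 𝓝[>] (0 : ℝ), ∀ v : HexVertex, (δ : ℂ) * hexCenter v ∈ K → v ∈ Λ' δ) →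
      Tendsto (fun δ : ℝ => (δ : ℂ) * hexMidpoint (a δ)) (𝓝[>] (0 : ℝ)) (𝓝 (D'.pt 0)) →
      Tendsto (fun δ : ℝ => (δ : ℂ) * hexMidpoint (b δ)) (𝓝[>] (0 : ℝ)) (𝓝 (D'.pt 1)) →
      (∀ᶠ δ : ℝ in 𝓝[>] (0 : ℝ), Λ' δ ⊆ Λ δ) →
      Tendsto (fun x => ‖Φ x‖) (𝓝[D.carrier] (D.pt 0)) atTop →
      Φ.HasBoundaryValue (D.pt 1) 0 →
      ContinuousOn L D.carrier → (∀ z ∈ D.carrier, Complex.exp (L z) = deriv Φ z) →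
      Tendsto L (𝓝[D.carrier] (D.pt 1)) (𝓝 Lb) →
      Tendsto (fun x => ‖Φ' x‖) (𝓝[D'.carrier] (D'.pt 0)) atTop →
      Φ'.HasBoundaryValue (D'.pt 1) 0 →
      ContinuousOn L' D'.carrier → (∀ z ∈ D'.carrier, Complex.exp (L' z) = deriv Φ' z) →
      Tendsto L' (𝓝[D'.carrier] (D'.pt 1)) (𝓝 Lb') →
      Tendsto (fun z => Φ' z / Φ z) (𝓝[D'.carrier] (D.pt 0)) (𝓝 1) →
      (∃ ℓ : ℝ → ℝ, ContinuousOn ℓ (Set.Ioo (-ρ) ρ \ {0}) ∧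
        (∀ x : ℝ, x ≠ 0 → |x| < ρ →
          Tendsto (fun z => (L z).re) (𝓝[D.carrier] (D.pt 0 + (x : ℂ))) (𝓝 (ℓ x))) ∧
        ∀ r r₀ ε : ℝ, 0 < r → r < r₀ → r₀ < ρ → 0 < ε →
          ∀ᶠ δ : ℝ in 𝓝[>] (0 : ℝ), ∀ p ∈ hexDomainBoundary (Λ δ),
            r ≤ dist ((δ : ℂ) * hexMidpoint p) (D.pt 0) → dist ((δ : ℂ) * hexMidpoint p) (D.pt 0) ≤ r₀ →
            |(hexParafermionicObservable (Λ δ) (a δ) hexCriticalFugacity 0 (p)).re -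
                Real.exp ((5 / 8 : ℝ) * (ℓ (((δ : ℂ) * hexMidpoint p - D.pt 0).re) - Lb.re)) *
                  (hexParafermionicObservable (Λ δ) (a δ) hexCriticalFugacity 0 (b δ)).re| ≤
              ε * (hexParafermionicObservable (Λ δ) (a δ) hexCriticalFugacity 0 (b δ)).re) →
      (∃ ℓ : ℝ → ℝ, ContinuousOn ℓ (Set.Ioo (-ρ) ρ \ {0}) ∧
        (∀ x : ℝ, x ≠ 0 → |x| < ρ →
          Tendsto (fun z => (L' z).re) (𝓝[D'.carrier] (D'.pt 0 + (x : ℂ))) (𝓝 (ℓ x))) ∧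
        ∀ r r₀ ε : ℝ, 0 < r → r < r₀ → r₀ < ρ → 0 < ε →
          ∀ᶠ δ : ℝ in 𝓝[>] (0 : ℝ), ∀ p ∈ hexDomainBoundary (Λ' δ),
            r ≤ dist ((δ : ℂ) * hexMidpoint p) (D'.pt 0) → dist ((δ : ℂ) * hexMidpoint p) (D'.pt 0) ≤ r₀ →
            |(hexParafermionicObservable (Λ' δ) (a δ) hexCriticalFugacity 0 (p)).re -
                Real.exp ((5 / 8 : ℝ) * (ℓ (((δ : ℂ) * hexMidpoint p - D'.pt 0).re) - Lb'.re)) *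
                  (hexParafermionicObservable (Λ' δ) (a δ) hexCriticalFugacity 0 (b δ)).re| ≤
              ε * (hexParafermionicObservable (Λ' δ) (a δ) hexCriticalFugacity 0 (b δ)).re) →
      (∀ r₀ : ℝ, 0 < r₀ → ∃ C : ℝ, ∀ᶠ δ : ℝ in 𝓝[>] (0 : ℝ),
        (∑ᶠ p ∈ {p : Sym2 HexVertex | p ∈ hexDomainBoundary (Λ δ) ∧
            r₀ ≤ dist ((δ : ℂ) * hexMidpoint p) (D.pt 0)},
            (hexParafermionicObservable (Λ δ) (a δ) hexCriticalFugacity 0 (p)).re) ≤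
          C / δ * (hexParafermionicObservable (Λ δ) (a δ) hexCriticalFugacity 0 (b δ)).re) →
      (∀ r₀ : ℝ, 0 < r₀ → ∃ C : ℝ, ∀ᶠ δ : ℝ in 𝓝[>] (0 : ℝ),
        (∑ᶠ p ∈ {p : Sym2 HexVertex | p ∈ hexDomainBoundary (Λ' δ) ∧
            r₀ ≤ dist ((δ : ℂ) * hexMidpoint p) (D'.pt 0)},
            (hexParafermionicObservable (Λ' δ) (a δ) hexCriticalFugacity 0 (p)).re) ≤
          C / δ * (hexParafermionicObservable (Λ' δ) (a δ) hexCriticalFugacity 0 (b δ)).re) →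
      Tendsto (fun δ : ℝ => (hexParafermionicObservable (Λ' δ) (a δ) hexCriticalFugacity 0 (b δ)).re /
          (hexParafermionicObservable (Λ δ) (a δ) hexCriticalFugacity 0 (b δ)).re)
        (𝓝[>] (0 : ℝ)) (𝓝 (Real.exp ((5 / 8 : ℝ) * (Lb'.re - Lb.re)))) := by
  sorry

/-! ## Stub 4 — restriction formula ⇒ identification of subsequential limits (LSW uniqueness in tree) -/

/-- STUB 4 — `stub_restrictionIdentifiesLaw` (size L–XL in Lean; mathematically classical + in-tree).
Sources / leans on: Portmanteau for the open events `rangeSubset D′` and closed events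
`rangeSubset (closure D′)` (tree `CurveClass.isOpen_rangeSubset`, `CurveClass.measurableSet_rangeSubset`);
exact lattice restriction `P_{Λ_δ}^{a→b}(γ ⊂ Λ′_δ) = Z_{Λ′_δ}/Z_{Λ_δ}` with the canonical discretisation
`Λ_δ = V(Ω_δ(D))` of a CONVEX domain flat-bottomed on `ℝ` (eventually simply connected, connected, all
honeycomb edges between its vertices are mesh edges, rows `x₁ ≥ 0` flat at EVERY mesh because the real axis
passes through the midpoints of the vertical edges between rows `−1` and `0` — lattice-geometry lemmas, M)
and hand-made lattice-polygonal bites `Λ′_δ` sandwiching a countable determining family of hull subdomains;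
the value conversion `|Φ′_{D′}(b)/Φ′_D(b)|^{5/8} = ν_SLE(D)(range ⊆ cl D′)` ([LSW03] Thm 6.1 transposed:
tree `sle_restriction_eightThirds_holds`, `hasSLETrace_eightThirds`,
`IsSLELaw.hullRestriction_eightThirds_of_hasSLETrace`, `measure_rangeSubset_compl_image_eq`, with the
`0 ↔ ∞` symmetry of the restriction exponent formula, checked in triage r1-1); continuity of the value
under monotone approximation of hulls ([LSW03] Lemma 3.5: tree `HasRestrictionDeriv.tendsto_of_kernel_holds`,
`IsPlusHull.exists_antitone_isArcHull_holds`); and the transfer "two laws carried by `chordalCarrier D`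
with equal avoidance probabilities of the image test sets coincide" (tree
`CurveClass.Measure.ext_of_missCode_injOn`, `injOn_missCode_imageTest`, `measurableSet_chordalCarrier`,
`exists_continuousOn_extension_holds`, Jordan arc separation) exactly as assembled in
`LawlerSchrammWerner2003_unique_of_facts` (RestrictionUniqueness.lean); SLE side: `exists_isSLECurve`
(discharged in tree for κ = 8/3 via `hasSLETrace_eightThirds`), `IsSLELaw.ae_simple`, `IsSLELaw.ae_endpoints`.
**Restriction formula ⇒ identification of the limit law.** Assume the restriction formula (the conclusion
of `stub_sourceResidueEngine`, for all nested admissible far-tame families of flat-ended hull pairs). Let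
`D` be a CONVEX Dobrushin domain whose marked points lie on the real axis with `D` flat (domain above) in
`B(a,ρ) ∪ B(b,ρ)`, and `a_δ, b_δ` hexagonal endpoint approximations (`IsEmbEndpointApprox`) which are
eventually up-vertices of row `0` (the inner vertices of the vertical boundary mid-edges on the bottom
line). Then every probability measure `μ` on `CurveClass ℂ` which is a subsequential weak limit of the
critical canonical SAW laws `hexSAWLaw D.carrier δ (a_δ) (b_δ)` pushed to curves, and which is carried by
the chordal carrier of `D`, is the chordal SLE_{8/3} law of `D`. -/
theorem stub_restrictionIdentifiesLaw :
    (∀ (D D' : DobrushinDomain) (ρ : ℝ) (Λ Λ' : ℝ → Finset HexVertex) (m : ℝ → ℤ) (a b : ℝ → Sym2 HexVertex)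
      (Φ : ConformalEquiv D.carrier upperHalfPlaneSet) (L : ℂ → ℂ) (Lb : ℂ)
      (Φ' : ConformalEquiv D'.carrier upperHalfPlaneSet) (L' : ℂ → ℂ) (Lb' : ℂ),
      0 < ρ →
      D.carrier ∩ ball (D.pt 0) ρ = {z : ℂ | (D.pt 0).im < z.im} ∩ ball (D.pt 0) ρ →
      D.carrier ∩ ball (D.pt 1) ρ = {z : ℂ | (D.pt 1).im < z.im} ∩ ball (D.pt 1) ρ →
      D'.carrier ∩ ball (D'.pt 0) ρ = {z : ℂ | (D'.pt 0).im < z.im} ∩ ball (D'.pt 0) ρ →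
      D'.carrier ∩ ball (D'.pt 1) ρ = {z : ℂ | (D'.pt 1).im < z.im} ∩ ball (D'.pt 1) ρ →
      D'.carrier ⊆ D.carrier → D'.pt 0 = D.pt 0 → D'.pt 1 = D.pt 1 →
      (∀ᶠ δ : ℝ in 𝓝[>] (0 : ℝ),
        hexDomainSimplyConnected (Λ δ) ∧ a δ ∈ hexDomainBoundary (Λ δ) ∧ b δ ∈ hexDomainBoundary (Λ δ) ∧
        Nonempty (HexMidEdgeSAW (Λ δ) (a δ) (b δ)) ∧
        (hexGraph.induce ((Λ δ : Finset HexVertex) : Set HexVertex)).Preconnected ∧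
        (∀ v ∈ Λ δ, (δ : ℂ) * hexCenter v ∈ D.carrier) ∧
        (∀ v : HexVertex, (δ : ℂ) * hexCenter v ∈ ball (D.pt 0) ρ ∪ ball (D.pt 1) ρ →
          (v ∈ Λ δ ↔ m δ ≤ v.1 1))) →
      (∀ K : Set ℂ, IsCompact K → K ⊆ D.carrier →
        ∀ᶠ δ : ℝ in 𝓝[>] (0 : ℝ), ∀ v : HexVertex, (δ : ℂ) * hexCenter v ∈ K → v ∈ Λ δ) →
      Tendsto (fun δ : ℝ => (δ : ℂ) * hexMidpoint (a δ)) (𝓝[>] (0 : ℝ)) (𝓝 (D.pt 0)) →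
      Tendsto (fun δ : ℝ => (δ : ℂ) * hexMidpoint (b δ)) (𝓝[>] (0 : ℝ)) (𝓝 (D.pt 1)) →
      (∀ᶠ δ : ℝ in 𝓝[>] (0 : ℝ),
        hexDomainSimplyConnected (Λ' δ) ∧ a δ ∈ hexDomainBoundary (Λ' δ) ∧ b δ ∈ hexDomainBoundary (Λ' δ) ∧
        Nonempty (HexMidEdgeSAW (Λ' δ) (a δ) (b δ)) ∧
        (hexGraph.induce ((Λ' δ : Finset HexVertex) : Set HexVertex)).Preconnected ∧
        (∀ v ∈ Λ' δ, (δ : ℂ) * hexCenter v ∈ D'.carrier) ∧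
        (∀ v : HexVertex, (δ : ℂ) * hexCenter v ∈ ball (D'.pt 0) ρ ∪ ball (D'.pt 1) ρ →
          (v ∈ Λ' δ ↔ m δ ≤ v.1 1))) →
      (∀ K : Set ℂ, IsCompact K → K ⊆ D'.carrier →
        ∀ᶠ δ : ℝ in 𝓝[>] (0 : ℝ), ∀ v : HexVertex, (δ : ℂ) * hexCenter v ∈ K → v ∈ Λ' δ) →
      Tendsto (fun δ : ℝ => (δ : ℂ) * hexMidpoint (a δ)) (𝓝[>] (0 : ℝ)) (𝓝 (D'.pt 0)) →
      Tendsto (fun δ : ℝ => (δ : ℂ) * hexMidpoint (b δ)) (𝓝[>] (0 : ℝ)) (𝓝 (D'.pt 1)) →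
      (∀ᶠ δ : ℝ in 𝓝[>] (0 : ℝ), Λ' δ ⊆ Λ δ) →
      (∀ r₀ : ℝ, 0 < r₀ → ∃ N : ℝ, ∀ᶠ δ : ℝ in 𝓝[>] (0 : ℝ),
        (Set.ncard {p : Sym2 HexVertex | p ∈ hexDomainBoundary (Λ δ) ∧
            r₀ ≤ dist ((δ : ℂ) * hexMidpoint p) (D.pt 0)} : ℝ) ≤ N / δ) →
      (∀ r₀ : ℝ, 0 < r₀ → ∃ N : ℝ, ∀ᶠ δ : ℝ in 𝓝[>] (0 : ℝ),
        (Set.ncard {p : Sym2 HexVertex | p ∈ hexDomainBoundary (Λ' δ) ∧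
            r₀ ≤ dist ((δ : ℂ) * hexMidpoint p) (D'.pt 0)} : ℝ) ≤ N / δ) →
      Tendsto (fun x => ‖Φ x‖) (𝓝[D.carrier] (D.pt 0)) atTop →
      Φ.HasBoundaryValue (D.pt 1) 0 →
      ContinuousOn L D.carrier → (∀ z ∈ D.carrier, Complex.exp (L z) = deriv Φ z) →
      Tendsto L (𝓝[D.carrier] (D.pt 1)) (𝓝 Lb) →
      Tendsto (fun x => ‖Φ' x‖) (𝓝[D'.carrier] (D'.pt 0)) atTop →
      Φ'.HasBoundaryValue (D'.pt 1) 0 →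
      ContinuousOn L' D'.carrier → (∀ z ∈ D'.carrier, Complex.exp (L' z) = deriv Φ' z) →
      Tendsto L' (𝓝[D'.carrier] (D'.pt 1)) (𝓝 Lb') →
      Tendsto (fun z => Φ' z / Φ z) (𝓝[D'.carrier] (D.pt 0)) (𝓝 1) →
      Tendsto (fun δ : ℝ => (hexParafermionicObservable (Λ' δ) (a δ) hexCriticalFugacity 0 (b δ)).re /
          (hexParafermionicObservable (Λ δ) (a δ) hexCriticalFugacity 0 (b δ)).re)
        (𝓝[>] (0 : ℝ)) (𝓝 (Real.exp ((5 / 8 : ℝ) * (Lb'.re - Lb.re))))) →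
    ∀ (D : DobrushinDomain) (ρ : ℝ) (a b : ℝ → HexVertex),
      Convex ℝ D.carrier → (D.pt 0).im = 0 → (D.pt 1).im = 0 →
      0 < ρ →
      D.carrier ∩ ball (D.pt 0) ρ = {z : ℂ | (D.pt 0).im < z.im} ∩ ball (D.pt 0) ρ →
      D.carrier ∩ ball (D.pt 1) ρ = {z : ℂ | (D.pt 1).im < z.im} ∩ ball (D.pt 1) ρ →
      IsEmbEndpointApprox hexGraph hexCenter D a b →
      (∀ᶠ δ : ℝ in 𝓝[>] (0 : ℝ), (a δ).2 = 0 ∧ (a δ).1 1 = 0 ∧ (b δ).2 = 0 ∧ (b δ).1 1 = 0) →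
      ∀ μ : Measure (CurveClass ℂ), IsProbabilityMeasure μ →
        IsSubseqLimitLaw (fun δ (γ : HexDomainSAW D.carrier δ (a δ) (b δ)) => γ.curve)
          (fun δ => hexSAWLaw D.carrier δ (a δ) (b δ)) μ →
        (∀ᵐ c ∂μ, c ∈ chordalCarrier D) →
        IsSLELaw ((8 : ℝ≥0) / 3) D μ := by
  sorry

/-! ## Stub 5 — range → curve: subsequential limits are carried by chordal simple curves (R2) -/

/-- STUB 5 — `stub_chordalCarrier` (R2, OPEN; shared residue of all four restriction cards, size L–XL).
Sources: card (R2) "RANGE → CURVE … needs no backtracking along its own simple trace for subsequential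
limits; tightness alone does not give it" and triage r1-1/2/3 (NoRetrace/NoBacktracking/NoParallelStrands,
one estimate, open); boundary avoidance away from `a, b` "comes out of the formula itself with collar
bites" (card Transfer: `Φ_A′(0) → 1` as a collar bite along `∂D ∖ (B(a,ε) ∪ B(b,ε))` shrinks, so
`μ(range meets ∂D off the marked points) = 0` by Portmanteau); endpoints `source = a`, `target = b` from
`IsEmbEndpointApprox` (`tendsto_fst/snd`, cf. landed `Negative/EndpointNecessity`); simplicity is the
genuinely open part: a subsequential limit of SELF-AVOIDING polygonal curves need not be simple (two strands
at mesoscopic distance `→ 0`), cf. the analogous issue for LERW/UST (LawlerSchrammWerner2004 §3) and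
percolation (Aizenman–Burchard 1999 regularity gives Hölder curves, not simplicity); for SAW the expected
tool is a two-arm/no-parallel-strands estimate of restriction type (sub-ballisticity inputs:
DuminilCopinHammond2013, arXiv:2310.17299). KemppainenSmirnov2017 §1 (what tightness does and does not give).
**Subsequential limits are carried by chordal simple curves.** Under the restriction formula, in the same
convex flat-bottomed class with row-`0` endpoints, every probability subsequential weak limit `μ` of the
canonical critical SAW curve laws gives full mass to `chordalCarrier D` = simple curve classes from `a` to
`b` whose trace lies in `D ∪ {a, b}`. -/
theorem stub_chordalCarrier :
    (∀ (D D' : DobrushinDomain) (ρ : ℝ) (Λ Λ' : ℝ → Finset HexVertex) (m : ℝ → ℤ) (a b : ℝ → Sym2 HexVertex)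
      (Φ : ConformalEquiv D.carrier upperHalfPlaneSet) (L : ℂ → ℂ) (Lb : ℂ)
      (Φ' : ConformalEquiv D'.carrier upperHalfPlaneSet) (L' : ℂ → ℂ) (Lb' : ℂ),
      0 < ρ →
      D.carrier ∩ ball (D.pt 0) ρ = {z : ℂ | (D.pt 0).im < z.im} ∩ ball (D.pt 0) ρ →
      D.carrier ∩ ball (D.pt 1) ρ = {z : ℂ | (D.pt 1).im < z.im} ∩ ball (D.pt 1) ρ →
      D'.carrier ∩ ball (D'.pt 0) ρ = {z : ℂ | (D'.pt 0).im < z.im} ∩ ball (D'.pt 0) ρ →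
      D'.carrier ∩ ball (D'.pt 1) ρ = {z : ℂ | (D'.pt 1).im < z.im} ∩ ball (D'.pt 1) ρ →
      D'.carrier ⊆ D.carrier → D'.pt 0 = D.pt 0 → D'.pt 1 = D.pt 1 →
      (∀ᶠ δ : ℝ in 𝓝[>] (0 : ℝ),
        hexDomainSimplyConnected (Λ δ) ∧ a δ ∈ hexDomainBoundary (Λ δ) ∧ b δ ∈ hexDomainBoundary (Λ δ) ∧
        Nonempty (HexMidEdgeSAW (Λ δ) (a δ) (b δ)) ∧
        (hexGraph.induce ((Λ δ : Finset HexVertex) : Set HexVertex)).Preconnected ∧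
        (∀ v ∈ Λ δ, (δ : ℂ) * hexCenter v ∈ D.carrier) ∧
        (∀ v : HexVertex, (δ : ℂ) * hexCenter v ∈ ball (D.pt 0) ρ ∪ ball (D.pt 1) ρ →
          (v ∈ Λ δ ↔ m δ ≤ v.1 1))) →
      (∀ K : Set ℂ, IsCompact K → K ⊆ D.carrier →
        ∀ᶠ δ : ℝ in 𝓝[>] (0 : ℝ), ∀ v : HexVertex, (δ : ℂ) * hexCenter v ∈ K → v ∈ Λ δ) →
      Tendsto (fun δ : ℝ => (δ : ℂ) * hexMidpoint (a δ)) (𝓝[>] (0 : ℝ)) (𝓝 (D.pt 0)) →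
      Tendsto (fun δ : ℝ => (δ : ℂ) * hexMidpoint (b δ)) (𝓝[>] (0 : ℝ)) (𝓝 (D.pt 1)) →
      (∀ᶠ δ : ℝ in 𝓝[>] (0 : ℝ),
        hexDomainSimplyConnected (Λ' δ) ∧ a δ ∈ hexDomainBoundary (Λ' δ) ∧ b δ ∈ hexDomainBoundary (Λ' δ) ∧
        Nonempty (HexMidEdgeSAW (Λ' δ) (a δ) (b δ)) ∧
        (hexGraph.induce ((Λ' δ : Finset HexVertex) : Set HexVertex)).Preconnected ∧
        (∀ v ∈ Λ' δ, (δ : ℂ) * hexCenter v ∈ D'.carrier) ∧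
        (∀ v : HexVertex, (δ : ℂ) * hexCenter v ∈ ball (D'.pt 0) ρ ∪ ball (D'.pt 1) ρ →
          (v ∈ Λ' δ ↔ m δ ≤ v.1 1))) →
      (∀ K : Set ℂ, IsCompact K → K ⊆ D'.carrier →
        ∀ᶠ δ : ℝ in 𝓝[>] (0 : ℝ), ∀ v : HexVertex, (δ : ℂ) * hexCenter v ∈ K → v ∈ Λ' δ) →
      Tendsto (fun δ : ℝ => (δ : ℂ) * hexMidpoint (a δ)) (𝓝[>] (0 : ℝ)) (𝓝 (D'.pt 0)) →
      Tendsto (fun δ : ℝ => (δ : ℂ) * hexMidpoint (b δ)) (𝓝[>] (0 : ℝ)) (𝓝 (D'.pt 1)) →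
      (∀ᶠ δ : ℝ in 𝓝[>] (0 : ℝ), Λ' δ ⊆ Λ δ) →
      (∀ r₀ : ℝ, 0 < r₀ → ∃ N : ℝ, ∀ᶠ δ : ℝ in 𝓝[>] (0 : ℝ),
        (Set.ncard {p : Sym2 HexVertex | p ∈ hexDomainBoundary (Λ δ) ∧
            r₀ ≤ dist ((δ : ℂ) * hexMidpoint p) (D.pt 0)} : ℝ) ≤ N / δ) →
      (∀ r₀ : ℝ, 0 < r₀ → ∃ N : ℝ, ∀ᶠ δ : ℝ in 𝓝[>] (0 : ℝ),
        (Set.ncard {p : Sym2 HexVertex | p ∈ hexDomainBoundary (Λ' δ) ∧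
            r₀ ≤ dist ((δ : ℂ) * hexMidpoint p) (D'.pt 0)} : ℝ) ≤ N / δ) →
      Tendsto (fun x => ‖Φ x‖) (𝓝[D.carrier] (D.pt 0)) atTop →
      Φ.HasBoundaryValue (D.pt 1) 0 →
      ContinuousOn L D.carrier → (∀ z ∈ D.carrier, Complex.exp (L z) = deriv Φ z) →
      Tendsto L (𝓝[D.carrier] (D.pt 1)) (𝓝 Lb) →
      Tendsto (fun x => ‖Φ' x‖) (𝓝[D'.carrier] (D'.pt 0)) atTop →
      Φ'.HasBoundaryValue (D'.pt 1) 0 →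
      ContinuousOn L' D'.carrier → (∀ z ∈ D'.carrier, Complex.exp (L' z) = deriv Φ' z) →
      Tendsto L' (𝓝[D'.carrier] (D'.pt 1)) (𝓝 Lb') →
      Tendsto (fun z => Φ' z / Φ z) (𝓝[D'.carrier] (D.pt 0)) (𝓝 1) →
      Tendsto (fun δ : ℝ => (hexParafermionicObservable (Λ' δ) (a δ) hexCriticalFugacity 0 (b δ)).re /
          (hexParafermionicObservable (Λ δ) (a δ) hexCriticalFugacity 0 (b δ)).re)
        (𝓝[>] (0 : ℝ)) (𝓝 (Real.exp ((5 / 8 : ℝ) * (Lb'.re - Lb.re))))) →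
    ∀ (D : DobrushinDomain) (ρ : ℝ) (a b : ℝ → HexVertex),
      Convex ℝ D.carrier → (D.pt 0).im = 0 → (D.pt 1).im = 0 →
      0 < ρ →
      D.carrier ∩ ball (D.pt 0) ρ = {z : ℂ | (D.pt 0).im < z.im} ∩ ball (D.pt 0) ρ →
      D.carrier ∩ ball (D.pt 1) ρ = {z : ℂ | (D.pt 1).im < z.im} ∩ ball (D.pt 1) ρ →
      IsEmbEndpointApprox hexGraph hexCenter D a b →
      (∀ᶠ δ : ℝ in 𝓝[>] (0 : ℝ), (a δ).2 = 0 ∧ (a δ).1 1 = 0 ∧ (b δ).2 = 0 ∧ (b δ).1 1 = 0) →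
      ∀ μ : Measure (CurveClass ℂ), IsProbabilityMeasure μ →
        IsSubseqLimitLaw (fun δ (γ : HexDomainSAW D.carrier δ (a δ) (b δ)) => γ.curve)
          (fun δ => hexSAWLaw D.carrier δ (a δ) (b δ)) μ →
        ∀ᵐ c ∂μ, c ∈ chordalCarrier D := by
  sorry

/-! ## Stub 6 — domain and endpoint universality (R3 = W2) -/

/-- STUB 6 — `stub_domainEndpointUniversality` (R3 = obstruction W2 of the crux attack, OPEN; shared by
EVERY line on this crux; size L–XL). Sources: CruxAttack10472 W2 and `Negative/HypothesisSilence`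
(`flat_premise_false_on_unitDisc`: the typed hypothesis is silent on domains not flat at the normalisation
point, while the conclusion quantifies over all Jordan `D` and all endpoint approximations);
`Negative/EndpointNecessity` (`hexConjecture_iff_endpoint_characterisation`: the `IsEmbEndpointApprox`
fields are exactly what convergence forces, so they stay as hypotheses here); the card's (R3) and
quantifier-hygiene remark (endpoint germs cannot be squeezed: a cone at an endpoint is a null event).
Mechanism available for the DOMAIN part: exact discrete restriction (the SAW law of `Ω_δ(D⁺)` conditioned
on staying in a sub-domain is the SAW law of the sub-domain) + the continuum restriction property of
SLE_{8/3} in the tree (`IsSLELaw.hullRestriction_eightThirds_of_hasSLETrace`) + Portmanteau handles every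
Jordan `D` sharing flat bottom pieces near `a, b` with a convex `D⁺` of the class; conformal covariance of
the SLE laws (`IsSLELaw.conformalCovariance_of_facts`) is the target symmetry. What has NO known mechanism
(the honest open part): non-flat boundary at the marked points, interior / general `IsEmbEndpointApprox`
endpoint sequences, and general position of `D` relative to the lattice (translations / rotations that are
not honeycomb symmetries) — endpoint universality without FKG (KennedyLawler2013 lattice effects persist in
boundary SAW ensembles; DCS arXiv:1007.0575 Conj. 1 is stated for all simply connected `Ω`).
**Domain and endpoint universality of the limit.** If the critical hexagonal SAW converges in law to
chordal SLE_{8/3} in every CONVEX Dobrushin domain flat-bottomed on the real axis near its marked points,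
for all hexagonal endpoint approximations by row-`0` up-vertices, and the laws are eventually tight for every
Dobrushin domain and endpoint approximation (`HexTight`), then for every Dobrushin domain and every hexagonal
endpoint approximation each probability subsequential weak limit of the curve laws is the chordal SLE_{8/3} law
(stated as IDENTIFICATION, which is equivalent to convergence by the landed `observableToSLE_iff_identification`
and keeps this stub textually distinct from `HexConjecture`). -/
theorem stub_domainEndpointUniversality :
    (∀ (D : DobrushinDomain) (ρ : ℝ) (a b : ℝ → HexVertex),
      Convex ℝ D.carrier → (D.pt 0).im = 0 → (D.pt 1).im = 0 →
      0 < ρ →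
      D.carrier ∩ ball (D.pt 0) ρ = {z : ℂ | (D.pt 0).im < z.im} ∩ ball (D.pt 0) ρ →
      D.carrier ∩ ball (D.pt 1) ρ = {z : ℂ | (D.pt 1).im < z.im} ∩ ball (D.pt 1) ρ →
      IsEmbEndpointApprox hexGraph hexCenter D a b →
      (∀ᶠ δ : ℝ in 𝓝[>] (0 : ℝ), (a δ).2 = 0 ∧ (a δ).1 1 = 0 ∧ (b δ).2 = 0 ∧ (b δ).1 1 = 0) →
      ConvergesInLawToSLE ((8 : ℝ≥0) / 3) D (fun δ (γ : HexDomainSAW D.carrier δ (a δ) (b δ)) => γ.curve)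
        (fun δ => hexSAWLaw D.carrier δ (a δ) (b δ))) →
    HexTight →
    ∀ (D : DobrushinDomain) (a b : ℝ → HexVertex), IsEmbEndpointApprox hexGraph hexCenter D a b →
      ∀ μ : Measure (CurveClass ℂ), IsProbabilityMeasure μ →
        IsSubseqLimitLaw (fun δ (γ : HexDomainSAW D.carrier δ (a δ) (b δ)) => γ.curve)
          (fun δ => hexSAWLaw D.carrier δ (a δ) (b δ)) μ →
        IsSLELaw ((8 : ℝ≥0) / 3) D μ := by
  sorry

/-! ## The composition: the six stubs give the crux BY NAME -/

/-- GLUE (proved): **the restriction formula** for every nested admissible far-tame discretisation pair of a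
flat-ended hull pair `D′ ⊆ D`, from stubs 1–3: the engine's four analytic inputs for the configuration at
hand are two instances of `stub_uniformTargetTransport` (for `(D, Λ_δ)` and `(D′, Λ′_δ)`, fed by the crux
hypothesis `HexObservableLimit` BY NAME) and two of `stub_farExitMassBound`. This statement is the
hypothesis of stubs 4 and 5, verbatim. [folklore] -/
theorem restrictionFormula_of (hO : HexObservableLimit) :
    ∀ (D D' : DobrushinDomain) (ρ : ℝ) (Λ Λ' : ℝ → Finset HexVertex) (m : ℝ → ℤ) (a b : ℝ → Sym2 HexVertex)
      (Φ : ConformalEquiv D.carrier upperHalfPlaneSet) (L : ℂ → ℂ) (Lb : ℂ)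
      (Φ' : ConformalEquiv D'.carrier upperHalfPlaneSet) (L' : ℂ → ℂ) (Lb' : ℂ),
      0 < ρ →
      D.carrier ∩ ball (D.pt 0) ρ = {z : ℂ | (D.pt 0).im < z.im} ∩ ball (D.pt 0) ρ →
      D.carrier ∩ ball (D.pt 1) ρ = {z : ℂ | (D.pt 1).im < z.im} ∩ ball (D.pt 1) ρ →
      D'.carrier ∩ ball (D'.pt 0) ρ = {z : ℂ | (D'.pt 0).im < z.im} ∩ ball (D'.pt 0) ρ →
      D'.carrier ∩ ball (D'.pt 1) ρ = {z : ℂ | (D'.pt 1).im < z.im} ∩ ball (D'.pt 1) ρ →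
      D'.carrier ⊆ D.carrier → D'.pt 0 = D.pt 0 → D'.pt 1 = D.pt 1 →
      (∀ᶠ δ : ℝ in 𝓝[>] (0 : ℝ),
        hexDomainSimplyConnected (Λ δ) ∧ a δ ∈ hexDomainBoundary (Λ δ) ∧ b δ ∈ hexDomainBoundary (Λ δ) ∧
        Nonempty (HexMidEdgeSAW (Λ δ) (a δ) (b δ)) ∧
        (hexGraph.induce ((Λ δ : Finset HexVertex) : Set HexVertex)).Preconnected ∧
        (∀ v ∈ Λ δ, (δ : ℂ) * hexCenter v ∈ D.carrier) ∧
        (∀ v : HexVertex, (δ : ℂ) * hexCenter v ∈ ball (D.pt 0) ρ ∪ ball (D.pt 1) ρ →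
          (v ∈ Λ δ ↔ m δ ≤ v.1 1))) →
      (∀ K : Set ℂ, IsCompact K → K ⊆ D.carrier →
        ∀ᶠ δ : ℝ in 𝓝[>] (0 : ℝ), ∀ v : HexVertex, (δ : ℂ) * hexCenter v ∈ K → v ∈ Λ δ) →
      Tendsto (fun δ : ℝ => (δ : ℂ) * hexMidpoint (a δ)) (𝓝[>] (0 : ℝ)) (𝓝 (D.pt 0)) →
      Tendsto (fun δ : ℝ => (δ : ℂ) * hexMidpoint (b δ)) (𝓝[>] (0 : ℝ)) (𝓝 (D.pt 1)) →
      (∀ᶠ δ : ℝ in 𝓝[>] (0 : ℝ),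
        hexDomainSimplyConnected (Λ' δ) ∧ a δ ∈ hexDomainBoundary (Λ' δ) ∧ b δ ∈ hexDomainBoundary (Λ' δ) ∧
        Nonempty (HexMidEdgeSAW (Λ' δ) (a δ) (b δ)) ∧
        (hexGraph.induce ((Λ' δ : Finset HexVertex) : Set HexVertex)).Preconnected ∧
        (∀ v ∈ Λ' δ, (δ : ℂ) * hexCenter v ∈ D'.carrier) ∧
        (∀ v : HexVertex, (δ : ℂ) * hexCenter v ∈ ball (D'.pt 0) ρ ∪ ball (D'.pt 1) ρ →
          (v ∈ Λ' δ ↔ m δ ≤ v.1 1))) →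
      (∀ K : Set ℂ, IsCompact K → K ⊆ D'.carrier →
        ∀ᶠ δ : ℝ in 𝓝[>] (0 : ℝ), ∀ v : HexVertex, (δ : ℂ) * hexCenter v ∈ K → v ∈ Λ' δ) →
      Tendsto (fun δ : ℝ => (δ : ℂ) * hexMidpoint (a δ)) (𝓝[>] (0 : ℝ)) (𝓝 (D'.pt 0)) →
      Tendsto (fun δ : ℝ => (δ : ℂ) * hexMidpoint (b δ)) (𝓝[>] (0 : ℝ)) (𝓝 (D'.pt 1)) →
      (∀ᶠ δ : ℝ in 𝓝[>] (0 : ℝ), Λ' δ ⊆ Λ δ) →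
      (∀ r₀ : ℝ, 0 < r₀ → ∃ N : ℝ, ∀ᶠ δ : ℝ in 𝓝[>] (0 : ℝ),
        (Set.ncard {p : Sym2 HexVertex | p ∈ hexDomainBoundary (Λ δ) ∧
            r₀ ≤ dist ((δ : ℂ) * hexMidpoint p) (D.pt 0)} : ℝ) ≤ N / δ) →
      (∀ r₀ : ℝ, 0 < r₀ → ∃ N : ℝ, ∀ᶠ δ : ℝ in 𝓝[>] (0 : ℝ),
        (Set.ncard {p : Sym2 HexVertex | p ∈ hexDomainBoundary (Λ' δ) ∧
            r₀ ≤ dist ((δ : ℂ) * hexMidpoint p) (D'.pt 0)} : ℝ) ≤ N / δ) →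
      Tendsto (fun x => ‖Φ x‖) (𝓝[D.carrier] (D.pt 0)) atTop →
      Φ.HasBoundaryValue (D.pt 1) 0 →
      ContinuousOn L D.carrier → (∀ z ∈ D.carrier, Complex.exp (L z) = deriv Φ z) →
      Tendsto L (𝓝[D.carrier] (D.pt 1)) (𝓝 Lb) →
      Tendsto (fun x => ‖Φ' x‖) (𝓝[D'.carrier] (D'.pt 0)) atTop →
      Φ'.HasBoundaryValue (D'.pt 1) 0 →
      ContinuousOn L' D'.carrier → (∀ z ∈ D'.carrier, Complex.exp (L' z) = deriv Φ' z) →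
      Tendsto L' (𝓝[D'.carrier] (D'.pt 1)) (𝓝 Lb') →
      Tendsto (fun z => Φ' z / Φ z) (𝓝[D'.carrier] (D.pt 0)) (𝓝 1) →
      Tendsto (fun δ : ℝ => (hexParafermionicObservable (Λ' δ) (a δ) hexCriticalFugacity 0 (b δ)).re /
          (hexParafermionicObservable (Λ δ) (a δ) hexCriticalFugacity 0 (b δ)).re)
        (𝓝[>] (0 : ℝ)) (𝓝 (Real.exp ((5 / 8 : ℝ) * (Lb'.re - Lb.re)))) := by
  intro D D' ρ Λ Λ' m a b Φ L Lb Φ' L' Lb' hρ hf0 hf1 hf0' hf1' hsub hp0 hp1 hA1 hA2 hA3 hA4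
    hA1' hA2' hA3' hA4' hnest hcnt hcnt' hC1 hC2 hC3 hC4 hC5 hC1' hC2' hC3' hC4' hC5' hnorm
  exact stub_sourceResidueEngine D D' ρ Λ Λ' m a b Φ L Lb Φ' L' Lb' hρ hf0 hf1 hf0' hf1' hsub hp0 hp1
    hA1 hA2 hA3 hA4 hA1' hA2' hA3' hA4' hnest hC1 hC2 hC3 hC4 hC5 hC1' hC2' hC3' hC4' hC5' hnorm
    (stub_uniformTargetTransport hO D ρ Λ m a b Φ L Lb hρ hf0 hf1 hA1 hA2 hA3 hA4 hC1 hC2 hC3 hC4 hC5)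
    (stub_uniformTargetTransport hO D' ρ Λ' m a b Φ' L' Lb' hρ hf0' hf1' hA1' hA2' hA3' hA4'
      hC1' hC2' hC3' hC4' hC5')
    (stub_farExitMassBound D ρ Λ m a b hρ hf0 hf1 hA1 hA2 hA3 hA4 hcnt)
    (stub_farExitMassBound D' ρ Λ' m a b hρ hf0' hf1' hA1' hA2' hA3' hA4' hcnt')


/-- **`ObservableToSLE` from the line `source-residue-restriction-pinning`.** Pure logic over the six
stubs and the landed soft half `convergesInLawToSLE_of_identification` (Negative/Identification.lean,
p69742): `HexObservableLimit` feeds `stub_uniformTargetTransport`; with `stub_farExitMassBound` the engine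
`stub_sourceResidueEngine` yields the restriction formula; for a good-class `(D′; a′, b′)` tightness
(`HexTight`) + identification of every subsequential limit (`stub_restrictionIdentifiesLaw`, fed by
`stub_chordalCarrier`) give convergence there; `stub_domainEndpointUniversality` transports the identification
to the given `(D; a, b)`, and the landed soft half turns it into convergence. Concludes the crux BY NAME; no
hypotheses. -/
theorem ObservableToSLE_of :
    Summit.CriticalPhenomena.SAWScalingLimit.Theses.SAWDevelopingMap.ObservableToSLE := by
  intro hO hT D a b hab
  have hRF := restrictionFormula_of hO
  apply convergesInLawToSLE_of_identification hab (hT D a b hab)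
  refine stub_domainEndpointUniversality ?_ hT D a b hab
  intro D' ρ a' b' hconv h0 h1 hρ hflat0 hflat1 hab' hrow
  exact convergesInLawToSLE_of_identification hab' (hT D' a' b' hab') (fun μ hμ hsub =>
    stub_restrictionIdentifiesLaw hRF D' ρ a' b' hconv h0 h1 hρ hflat0 hflat1 hab' hrow μ hμ hsub
      (stub_chordalCarrier hRF D' ρ a' b' hconv h0 h1 hρ hflat0 hflat1 hab' hrow μ hμ hsub))

end Summit.CriticalPhenomena.SAWScalingLimit.Cruxes.ObservableToSLE.SourceResidueRestrictionPinning

end
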